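import Summits.ResolutionOfSingularities.ResolutionOfSingularities.Theorems.EquisingularLiftEquisingularLiftNatNDChartEnd
import HarnessLib

/-!
# [OURS · L1 W4.5(b) · EL♮(3)] ND CHART DICTIONARY (3/3) — `…NatNDChartPlays`: convenience (`not_bad_coordinateFace`: every legal centre lies over the point),
# smooth natural charts along every play (`isSmoothCone_of_reach_orthant`), and the dictionary along a whole won play (`e1_along_play`, `end_of_wonPlay`, `end_of_localNDWon`)

OURS · L1 W4.5(b) · EL♮(3) stmt-ResolutionOfSingularities-20148 · counted 0 · AI-written (res-L1-w45b-idea-1 g22; landed in the text owner's lane by res-L1-w45b-lead-2 g6 on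
idea-1's OFFER R8-4), weaker than expert review; nothing of [Hironaka2017] asserted; no statement of the manuscript. Sorry-free, axioms standard, no instance, no
notation. `--supports stmt-ResolutionOfSingularities-20148 --as helper`: support module toward the registered 4th CHILD stub
`stub_elnat_three_isolated_newtonNondegenerate` (`IsoHypNDWon → ELNatConclusionO`, first unproved lemma `nd_rung_local`): this is the PROVED `k`-SIDE of that
rung's toric dictionary; the `O`-side plumbing (O1)–(O5) of `Cruxes/EquisingularLiftNatThree/NewtonNondegenerateRung.lean` §10.3 is untouched.
SOURCE = idea-1's companion `Cruxes/EquisingularLiftNatThree/NewtonNondegenerateRungCharts.lean` sha16 54ad50e211ef87b7 (658 l., farm rc 0 · 0 sorries), bodies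
VERBATIM; tree home = namespace `…Cruxes.EquisingularLiftNat.Sections.ND` (text owner's ruling on R8-4), imports route-independent, prelude lemmas public, split by
the 400-line rule into `…NatNDChartPullback` (§12.1–§12.2) → `…NatNDChartEnd` (§12.3) → `…NatNDChartPlays` (§12.4–§12.6).
-/

noncomputable section

set_option linter.dupNamespace false

open MvPolynomial

namespace Summit.ResolutionOfSingularities.ResolutionOfSingularities.Cruxes.EquisingularLiftNat.Sections.ND

open Summit.ResolutionOfSingularities.ResolutionOfSingularities.Cruxes.EquisingularLiftNat.Sections

variable {k : Type} [Field k] {N : ℕ} {n : ℕ}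

/-! ### 12.4 Convenience: no legal centre off the point; `Won` ⇒ no face is `Bad` -/

/-- Pairing with the standard ray `e_i` reads off the `i`-th exponent. [OURS · ND chart dictionary, res-L1-w45b-idea-1 g22] -/
theorem pair_e (i : Fin n) (m : Fin n → ℕ) : pair (e n i) m = (m i : ℤ) := by
  simp [pair, e, Pi.single_apply]

/-- A CONVENIENT table has no `Bad` PROPER coordinate face: every E1-legal centre of the local game lies over the point (it is either the point itself
— the full orthant — or contains an exceptional ray). -/
theorem not_bad_coordinateFace {V : Finset (Fin n → ℕ)} (hV : IsConvenientTable V) {I : Finset (Fin n)} {j : Fin n} (hj : j ∉ I) :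
    ¬ Bad V (I.image (e n)) := by
  obtain ⟨h0, hax⟩ := hV
  obtain ⟨v, hv, hvj, hv0⟩ := hax j
  intro hB; apply hB
  refine ⟨v, hv, fun ρ hρ m' hm' => ?_⟩
  obtain ⟨i, hi, rfl⟩ := Finset.mem_image.1 hρ
  have hij : i ≠ j := fun h => hj (h ▸ hi)
  rw [pair_e, pair_e, hv0 i hij]
  exact_mod_cast Nat.zero_le _

/-- At a `Won` position no face of any maximal cone is `Bad` (the support function is linear on the whole fan). -/
theorem not_bad_face_of_won {V : Finset (Fin n → ℕ)} {F : Finset (Finset (Ray n))} (hW : Won V F) {σ τ : Finset (Ray n)}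
    (hσ : σ ∈ F) (hτ : τ ⊆ σ) : ¬ Bad V τ :=
  fun hB => hW σ hσ (bad_mono V hτ hB)

/-- The table of a convenient polynomial is a convenient table. -/
theorem isConvenientTable_table {g : MvPolynomial (Fin n) k} (hg : IsConvenient g) : IsConvenientTable (table g) := by
  classical
  obtain ⟨h0, hax⟩ := hg
  refine ⟨?_, fun i => ?_⟩
  · intro hmem
    rw [mem_table_iff, mem_support_iff] at hmem
    apply hmem
    have : toFs (0 : Fin n → ℕ) = 0 := by ext i; simp [toFs]
    rw [this]; exact h0
  · obtain ⟨m, hm, hcoeff⟩ := hax i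
    refine ⟨⇑(Finsupp.single i m), coe_mem_table (mem_support_iff.2 hcoeff), ?_, fun j hj => ?_⟩
    · rw [Finsupp.single_eq_same]; exact hm
    · rw [Finsupp.single_eq_of_ne hj]

/-! ### 12.5 Every position of the local game is SMOOTH with natural rays — the chart hypotheses of 12.2/12.3 are automatic (PROVED) -/

/-- The `ℤ`-matrix of a natural chart basis. -/
def zMat (B : Fin n → Fin n → ℕ) : Matrix (Fin n) (Fin n) ℤ := Matrix.of fun i l => (B i l : ℤ)

/-- The `i`-th row of `zMat B` is the ray `rayOf (B i)`. [OURS · ND chart dictionary, res-L1-w45b-idea-1 g22] -/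
theorem zMat_row (B : Fin n → Fin n → ℕ) (i : Fin n) : zMat B i = rayOf (B i) := by
  funext l; rfl

/-- A SMOOTH CONE with natural rays: `σ = {rayOf (B i) : i}` for a chart basis `B ∈ ℕ^{n×n}` with `det B = ±1` (a unimodular cone inside the orthant). -/
def IsSmoothCone (σ : Finset (Ray n)) : Prop :=
  ∃ B : Fin n → Fin n → ℕ, σ = Finset.univ.image (fun i => rayOf (B i)) ∧ IsUnit (zMat B).det

/-- The rows of a unimodular natural matrix are pairwise distinct rays. [OURS · ND chart dictionary, res-L1-w45b-idea-1 g22] -/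
theorem rayOf_injective_of_isUnit (B : Fin n → Fin n → ℕ) (hB : IsUnit (zMat B).det) :
    Function.Injective (fun i => rayOf (B i)) := by
  intro i j hij
  by_contra hne
  have h0 : (zMat B).det = 0 := Matrix.det_zero_of_row_eq hne (by rw [zMat_row, zMat_row]; exact hij)
  rw [h0] at hB
  exact not_isUnit_zero hB

/-- `det B = ±1` in `ℤ` ⟹ `det B ≠ 0` in EVERY field (the END lemma's hypothesis, characteristic-free). -/
theorem det_cast_ne_zero_of_isUnit (B : Fin n → Fin n → ℕ) (hB : IsUnit (zMat B).det) :
    (Matrix.of fun i l => (B i l : k)).det ≠ 0 := by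
  have hmap : (Matrix.of fun i l => (B i l : k)) = (Int.castRingHom k).mapMatrix (zMat B) := by
    ext i l; simp [zMat]
  rw [hmap, ← RingHom.map_det]
  rcases Int.isUnit_iff.1 hB with h | h <;> rw [h] <;> simp

/-- A unimodular integer matrix has non-zero determinant. [OURS · ND chart dictionary, res-L1-w45b-idea-1 g22] -/
theorem zdet_ne_zero_of_isUnit (B : Fin n → Fin n → ℕ) (hB : IsUnit (zMat B).det) :
    (Matrix.of fun i l => (B i l : ℤ)).det ≠ 0 := hB.ne_zero

/-- The starting orthant is a smooth cone (`B = 1`). -/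
theorem isSmoothCone_orthant : IsSmoothCone (Finset.univ.image (e n)) := by
  classical
  refine ⟨fun i l => if i = l then 1 else 0, ?_, ?_⟩
  · congr 1; funext i; funext l
    by_cases h : i = l
    · subst h; simp [rayOf, e]
    · simp [rayOf, e, h, Ne.symm h]
  · have h1 : zMat (fun i l => if i = l then 1 else 0 : Fin n → Fin n → ℕ) = 1 := by
      ext i l; simp [zMat, Matrix.one_apply]
    rw [h1, Matrix.det_one]; exact isUnit_one

/-- **One star keeps cones smooth** (Cox–Little–Schenck 3.3.15 at the level of bases): replacing the ray `t ∈ τ ⊆ σ` by `e_τ = Σ_{ρ∈τ} ρ` is the row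
operation «add the other rows of `τ` to the row of `t`», which keeps natural coordinates and `det = ±1`. -/
theorem isSmoothCone_starCone {σ τ : Finset (Ray n)} (hσ : IsSmoothCone σ) (hτσ : τ ⊆ σ) {t : Ray n} (ht : t ∈ τ) :
    IsSmoothCone (insert (∑ ρ ∈ τ, ρ) (σ.erase t)) := by
  classical
  obtain ⟨B, rfl, hdet⟩ := hσ
  have hinj := rayOf_injective_of_isUnit B hdet
  obtain ⟨i₀, -, hi₀⟩ := Finset.mem_image.1 (hτσ ht)
  set J : Finset (Fin n) := Finset.univ.filter (fun j => rayOf (B j) ∈ τ) with hJ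
  have hi₀J : i₀ ∈ J := by
    rw [hJ, Finset.mem_filter]; refine ⟨Finset.mem_univ _, ?_⟩; rw [hi₀]; exact ht
  have hτJ : τ = J.image (fun j => rayOf (B j)) := by
    ext ρ
    constructor
    · intro hρ
      obtain ⟨j, -, rfl⟩ := Finset.mem_image.1 (hτσ hρ)
      exact Finset.mem_image_of_mem _ (by rw [hJ, Finset.mem_filter]; exact ⟨Finset.mem_univ _, hρ⟩)
    · intro hρ
      obtain ⟨j, hj, rfl⟩ := Finset.mem_image.1 hρ
      exact (Finset.mem_filter.1 hj).2
  set B' : Fin n → Fin n → ℕ := Function.update B i₀ (fun l => ∑ j ∈ J, B j l) with hB'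
  have hB'i₀ : B' i₀ = fun l => ∑ j ∈ J, B j l := by rw [hB', Function.update_self]
  have hB'ne : ∀ i, i ≠ i₀ → B' i = B i := fun i hi => by rw [hB', Function.update_of_ne hi]
  have hray₀ : rayOf (B' i₀) = ∑ ρ ∈ τ, ρ := by
    rw [hτJ, Finset.sum_image hinj.injOn]
    funext l
    rw [hB'i₀]; simp only [rayOf, Finset.sum_apply, Nat.cast_sum]
  refine ⟨B', ?_, ?_⟩
  · have hR : Finset.univ.image (fun i => rayOf (B' i)) =
        insert (rayOf (B' i₀)) ((Finset.univ.erase i₀).image (fun i => rayOf (B' i))) := by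
      conv_lhs => rw [← Finset.insert_erase (Finset.mem_univ i₀)]
      rw [Finset.image_insert]
    have hL : (Finset.univ.image (fun i => rayOf (B i))).erase t = (Finset.univ.erase i₀).image (fun i => rayOf (B i)) := by
      rw [← hi₀, ← Finset.image_erase hinj]
    have hmid : (Finset.univ.erase i₀).image (fun i => rayOf (B' i)) = (Finset.univ.erase i₀).image (fun i => rayOf (B i)) :=
      Finset.image_congr fun i hi => by
        have hne : i ≠ i₀ := Finset.ne_of_mem_erase (Finset.mem_coe.1 hi)
        show rayOf (B' i) = rayOf (B i)
        rw [hB'ne i hne]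
    rw [hR, hL, hmid, hray₀]
  · have hz : zMat B' = (zMat B).updateRow i₀ (∑ j, (if j ∈ J then (1 : ℤ) else 0) • (zMat B) j) := by
      ext i l
      by_cases hi : i = i₀
      · rw [hi, Matrix.updateRow_self, Finset.sum_apply]
        simp only [zMat, Matrix.of_apply, Pi.smul_apply, smul_eq_mul, hB'i₀, Nat.cast_sum, ite_mul, one_mul, zero_mul]
        rw [Finset.sum_ite_mem, Finset.univ_inter]
      · rw [Matrix.updateRow_ne hi]
        simp only [zMat, Matrix.of_apply, hB'ne i hi]
    rw [hz, Matrix.det_updateRow_sum, if_pos hi₀J, one_smul]; exact hdet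

/-- **Every position reachable by stars from smooth cones consists of smooth cones** — in particular every position of the LOCAL game (start
`orthantFan n`): the charts of 12.2/12.3 exist at every stage of every E1-legal play, with `det = ±1`. -/
theorem isSmoothCone_of_reach (V : Finset (Fin n → ℕ)) {F₀ F : Finset (Finset (Ray n))} (h : Reach V F₀ F)
    (h₀ : ∀ σ ∈ F₀, IsSmoothCone σ) : ∀ σ ∈ F, IsSmoothCone σ := by
  classical
  induction h with
  | refl => exact h₀
  | step F₂ τ σ hR hσ hτσ hne hBad ih =>
    intro γ hγ
    simp only [Summit.ResolutionOfSingularities.ResolutionOfSingularities.Cruxes.EquisingularLiftNat.Sections.star, Finset.mem_union,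
      Finset.mem_filter, Finset.mem_biUnion, Finset.mem_image] at hγ
    rcases hγ with ⟨hγF, -⟩ | ⟨σ₁, ⟨hσ₁F, hτσ₁⟩, t, ht, rfl⟩
    · exact ih γ hγF
    · exact isSmoothCone_starCone (ih σ₁ hσ₁F) hτσ₁ ht

/-- Every maximal cone of every position reachable from `orthantFan n` is smooth with natural rays. [OURS · ND chart dictionary, res-L1-w45b-idea-1 g22] -/
theorem isSmoothCone_of_reach_orthant (V : Finset (Fin n → ℕ)) {F : Finset (Finset (Ray n))} (h : Reach V (orthantFan n) F)
    {σ : Finset (Ray n)} (hσ : σ ∈ F) : IsSmoothCone σ :=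
  isSmoothCone_of_reach V h (fun σ' hσ' => by
    rw [orthantFan, Finset.mem_singleton] at hσ'; rw [hσ']; exact isSmoothCone_orthant) σ hσ

/-! ### 12.6 The dictionary along a whole E1-legal play of the local game (PROVED) -/

/-- **E1 ALONG THE PLAY.**  At every position `F` of a play from `orthantFan n` on `table g`, for every maximal cone `σ ∈ F` with its chart `B`
and every legal (= `Bad`) face `τ ⊆ σ`: the orbit closure `V(τ) ∩ U_σ` lies inside the strict transform of `{g = 0}` — every monomial of
`toricStrict B g` involves a `τ`-variable. -/
theorem e1_along_play {g : MvPolynomial (Fin n) k} {F : Finset (Finset (Ray n))} (hR : Reach (table g) (orthantFan n) F)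
    {σ : Finset (Ray n)} (hσ : σ ∈ F) :
    ∃ B : Fin n → Fin n → ℕ, σ = Finset.univ.image (fun i => rayOf (B i)) ∧ IsUnit (zMat B).det ∧
      ∀ I : Finset (Fin n), Bad (table g) (I.image fun i => rayOf (B i)) ↔
        ∀ e ∈ (toricStrict B g).support, ∃ i ∈ I, e i ≠ 0 := by
  obtain ⟨B, hB, hdet⟩ := isSmoothCone_of_reach_orthant (table g) hR hσ
  exact ⟨B, hB, hdet, fun I => bad_iff_toricStrict_vanishes B (zdet_ne_zero_of_isUnit B hdet) g I⟩

/-- **THE END OF A WON PLAY (PROVED `k`-side of the rung).**  For a LOCALLY Newton-nondegenerate `g` and ANY won position `F'` reached by an E1-legal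
play of the local game: every maximal cone `σ ∈ F'` has a smooth natural chart `B` (`det = ±1`), and in that chart, along EVERY torus orbit lying over
the origin, the strict transform of `{g = 0}` has a non-vanishing partial in an orbit direction at each of its points — by the Jacobian criterion it is
SMOOTH of codimension one and TRANSVERSAL to the orbit there.  This is the chart computation of Khovanskii 1977 / Ishii Lemma 4.4.24, now a theorem of
this file; what `nd_rung_local` still owes is the `O`-side plumbing (the toric `O`-tower of the play and the Jacobian criterion turned into `IsRegular`). -/
theorem end_of_wonPlay {g : MvPolynomial (Fin n) k} (hND : IsLocallyNewtonNondegenerate g) {F' : Finset (Finset (Ray n))}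
    (hR : Reach (table g) (orthantFan n) F') (hW : Won (table g) F') {σ : Finset (Ray n)} (hσ : σ ∈ F') :
    ∃ B : Fin n → Fin n → ℕ, σ = Finset.univ.image (fun i => rayOf (B i)) ∧ IsUnit (zMat B).det ∧
      ∀ I : Finset (Fin n), (∀ l, ∃ i ∈ I, 0 < B i l) →
        ∀ y : Fin n → k, (∀ i ∈ I, y i = 0) → (∀ j, j ∉ I → y j ≠ 0) → eval y (toricStrict B g) = 0 →
          ∃ j, j ∉ I ∧ eval y (pderiv j (toricStrict B g)) ≠ 0 := by
  obtain ⟨B, hB, hdet⟩ := isSmoothCone_of_reach_orthant (table g) hR hσ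
  refine ⟨B, hB, hdet, fun I hw y hy0 hy1 hGy => ?_⟩
  have hI : ¬ Bad (table g) (I.image fun i => rayOf (B i)) :=
    not_bad_face_of_won hW hσ (by rw [hB]; exact Finset.image_subset_image (Finset.subset_univ I))
  exact exists_eval_pderiv_toricStrict_ne_zero B (det_cast_ne_zero_of_isUnit B hdet) hND I hI hw y hy0 hy1 hGy

/-- The same for a member of the residue interface `LocalNDWon` (what `IsoHypNDWon` provides at every singular point). -/
theorem end_of_localNDWon {g : MvPolynomial (Fin n) k} (h : LocalNDWon g) :
    ∃ F' : Finset (Finset (Ray n)), Reach (table g) (orthantFan n) F' ∧ Won (table g) F' ∧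
      ∀ σ ∈ F', ∃ B : Fin n → Fin n → ℕ, σ = Finset.univ.image (fun i => rayOf (B i)) ∧ IsUnit (zMat B).det ∧
        ∀ I : Finset (Fin n), (∀ l, ∃ i ∈ I, 0 < B i l) →
          ∀ y : Fin n → k, (∀ i ∈ I, y i = 0) → (∀ j, j ∉ I → y j ≠ 0) → eval y (toricStrict B g) = 0 →
            ∃ j, j ∉ I ∧ eval y (pderiv j (toricStrict B g)) ≠ 0 := by
  obtain ⟨⟨hconv, hND⟩, F', hR, hW⟩ := h
  exact ⟨F', hR, hW, fun σ hσ => end_of_wonPlay hND hR hW hσ⟩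

end Summit.ResolutionOfSingularities.ResolutionOfSingularities.Cruxes.EquisingularLiftNat.Sections.ND

end
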